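import Summits.CriticalPhenomena.Ising3DConformalLimit.Theorems.ArmHyperscalingOneArmHyperscalingReduction
import Summits.CriticalPhenomena.Ising3DConformalLimit.Theorems.ArmHyperscalingOneArmHyperscalingStubRpIndicatorCs
import Summits.CriticalPhenomena.Ising3DConformalLimit.Theorems.ArmHyperscalingOneArmHyperscalingStubPatchReflection
import HarnessLib

/-!
# Crux `ArmHyperscaling.OneArmHyperscaling` (stmt-CriticalPhenomena-15591) REDUCED to the bounded Casimir overlap
(line `mirror-face-saturation`, Casimir variant; lead prover-line-stmt-CriticalPhenomena-15591-0, 2026-08-17)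

A second sorry-free reduction of the crux, independent of the face-saturation inequality `FaceSaturation`:

  `OneArmHyperscaling_of_casimir : CasimirBound → OneArmHyperscaling`      (registered glue sub-goal)

where `CasimirBound` (definitions module, p161902) says that for some ratio `K ≥ 2` the probability that the two
mirror patches `A = mirrorPatch K n`, `θA = facePatch K n` are BOTH entirely plus is at most a constant times the
product of the single-patch probabilities, uniformly in `n` (bounded critical Casimir interaction free energy of two
facing plus plates of half-width `Kn` at distance `2((K−1)n+1)`).

Proof (all inputs landed): reflection positivity of the critical state with the INDICATOR of the mirror patch as test
observable, `rp_indicator_cs` (p162887): `(N + N')² ≤ 4·⟨σ₀σ_{2ne₀}⟩·⟨𝟙_{A⁺}𝟙_{θA⁺}⟩` with `N = ⟨σ_x𝟙_{θA⁺}⟩`,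
`N' = ⟨σ_{θx}𝟙_{A⁺}⟩`; reflection invariance `patch_reflection` (p162331): `N' = N`, `⟨𝟙_{A⁺}⟩ = ⟨𝟙_{θA⁺}⟩ =: D > 0`;
hence `N² ≤ ⟨σ₀σ_{2ne₀}⟩ · ⟨𝟙_{A⁺}𝟙_{θA⁺}⟩ ≤ C ⟨σ₀σ_{2ne₀}⟩ D²`, i.e. `F² = (N/D)² ≤ C⟨σ₀σ_{2ne₀}⟩` for the
face-conditioned magnetisation `F = faceMag K n`; and face subadditivity `faceSubadditivity_proof` (p161618):
`0 ≤ m⁺_{Kn} ≤ 6F`.  So `(m⁺_{Kn})² ≤ 36 C ⟨σ₀σ_{2ne₀}⟩`.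

Scaling check (why this is not a free lunch): `−log(⟨𝟙_{A⁺}𝟙_{θA⁺}⟩/⟨𝟙_{A⁺}⟩²) ≍ (Kn)²/dist² = O(1)` in `d = 3`
(hyperscaling form of the critical Casimir energy) but grows like `ℓ^{d−4}` in mean field, so `CasimirBound` fails for
`d > 4` exactly like the crux; it is an OPEN one-scale free-energy statement, recorded as an alternative open core.
-/

noncomputable section

namespace Summit.CriticalPhenomena.Ising3DConformalLimit.Cruxes.OneArmHyperscaling.MirrorFaceSaturation

open Literature.Probability.LatticeModels Finset

/-- **The crux from the bounded Casimir overlap** (registered glue sub-goal `OneArmHyperscaling_of_casimir`):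
`CasimirBound → OneArmHyperscaling`, with ratio `K` from the hypothesis and constant `36 C`. -/
theorem OneArmHyperscaling_of_casimir :
    CasimirBound → Summit.CriticalPhenomena.Ising3DConformalLimit.Theses.ArmHyperscaling.OneArmHyperscaling := by
  rintro ⟨K, hK, C, hC⟩
  refine ⟨K, by omega, 36 * C, fun n hn => ?_⟩
  -- inputs (before abstracting the expectations)
  have hrp := rp_indicator_cs K n hK hn
  obtain ⟨hDADE, hN'N, hDEpos⟩ := patch_reflection K n
  have hcas := hC n hn
  obtain ⟨hm0, hm⟩ := faceSubadditivity_proof K n hK hn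
  have hP0 : 0 ≤ criticalTwoPoint 3 (Pi.single 0 (2 * (n : ℤ))) := criticalTwoPoint_nonneg' _
  unfold faceMag at hm
  -- abstract the five expectations and the two-point value
  generalize hN : critExpect (fun σ => spinAt (evalSite n) σ * plusIndicator (facePatch K n) σ) = N at *
  generalize hN' : critExpect (fun σ => spinAt (Pi.single 0 (-(n : ℤ))) σ *
    plusIndicator (mirrorPatch K n) σ) = N' at *
  generalize hB : critExpect (fun σ => plusIndicator (mirrorPatch K n) σ * plusIndicator (facePatch K n) σ) = B at *
  generalize hDA : critExpect (plusIndicator (mirrorPatch K n)) = DA at *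
  generalize hDE : critExpect (plusIndicator (facePatch K n)) = DE at *
  generalize hP : criticalTwoPoint 3 (Pi.single 0 (2 * (n : ℤ))) = P at *
  -- now: hrp : (N + N')² ≤ 4 P B, hN'N : N' = N, hDADE : DA = DE, hcas : B ≤ C (DA DE), hm : m ≤ 6 (N/DE)
  subst hN'N
  have hN2 : N' ^ 2 ≤ P * B := by nlinarith [hrp]
  have hN2' : N' ^ 2 ≤ C * P * DE ^ 2 := by
    calc N' ^ 2 ≤ P * B := hN2
      _ ≤ P * (C * (DA * DE)) := mul_le_mul_of_nonneg_left hcas hP0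
      _ = C * P * DE ^ 2 := by rw [hDADE]; ring
  have hF2 : (N' / DE) ^ 2 ≤ C * P := by
    rw [div_pow, div_le_iff₀ (pow_pos hDEpos 2)]
    linarith [hN2']
  calc plusBoxMag K n ^ 2 ≤ (6 * (N' / DE)) ^ 2 := pow_le_pow_left₀ hm0 hm 2
    _ = 36 * (N' / DE) ^ 2 := by ring
    _ ≤ 36 * (C * P) := by linarith [hF2]
    _ = 36 * C * P := by ring

end Summit.CriticalPhenomena.Ising3DConformalLimit.Cruxes.OneArmHyperscaling.MirrorFaceSaturation

end
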